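import Summits.Ventures.Crystal3D.Theorems.StickyWulffConstantNoReconstructionGainCapLocal
import HarnessLib

/-!
# Per-ball cap accounting: the (T2)-excess of the cap transfer equals
# `2·(interstitial below) + (interstitial level) − 2·(vacant down-caps) − (vacant level caps)` up to rim terms

HONEST FRAMING. Part of the venture `Summits/Ventures/Crystal3D` (cell `crystal3d-full`), helper
`--supports` the crux `NoReconstructionGain` (stmt-Ventures-19144, route
`route-Ventures-StickyWulffConstant`), line `adhesion`; the LOCAL half of the gain identity
(`…NoReconstructionGainInterstitialGain`, wulff-p1 g10).

Fix a finite unit packing `X ⊇ P`, a twelve-element set `U` of unit vectors of `Λ₀` closed under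
negation (the bond star), a direction `ν` and a film ball `q ∈ X \ P`.  Every cap
`{y : ⟪y − q, d⟫ > √3/2}` (`d ∈ U`) holds at most one contact of `q` and every contact lies in at
most one cap (`…CapLocal`), so the contacts of `q` split into REGISTERED ones (in bijection with the
OCCUPIED caps) and INTERSTITIAL ones, and the caps split into substrate-occupied / film-occupied /
VACANT.  With the cap transfer `g x y = [x in a down-cap of y] + [x interstitial and ν-below y]`,
`t x y = g x y − g y x`:

* `perBall_capAccount_eq` / `perBall_capAccount` / `perBall_capAccount_ge` — EXACTLY (resp. bounding the last
  two rim terms above by twice the substrate contacts in caps `d` with `⟪d,ν⟫ ≥ 0`, resp. dropping them):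
  `2·#plug(q) + #film(q) + Σ_{x ∼ q, film} t x q = 12 + 2·#{interstitial
  substrate contacts} + 2·#{interstitial film contacts ν-below q} + #{interstitial film contacts
  ν-level with q} − 2·#{vacant caps d, ⟪d,ν⟫ < 0} − #{vacant caps d, ⟪d,ν⟫ = 0} + 2·#{substrate
  contacts in a cap d with ⟪d,ν⟫ > 0} + #{substrate contacts in a cap d with ⟪d,ν⟫ = 0}` (the last two terms
  vanish off the rim of a slab sample).

WHAT THIS IS NOT: no statement about which films satisfy the resulting rule; rung F-C1 not moved.
-/

noncomputable section

namespace Summit.Ventures.Crystal3D.Theorems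

open Summit.Ventures.Crystal3D Finset
open Literature.MathematicalPhysics.StatisticalMechanics (fccStacking)
open scoped InnerProductSpace

/-- **Per-ball cap accounting, exact form** (see the module docstring): the (T2)-excess of the cap
transfer at `q` equals `2·(interstitial below) + (interstitial level) − 2·(vacant down-caps) −
(vacant level caps) + 2·(substrate contacts in up-caps) + (substrate contacts in level caps)`. -/
theorem perBall_capAccount_eq (X P : Finset (EuclideanSpace ℝ (Fin 3)))
    (hX : ∀ p ∈ X, ∀ q ∈ X, p ≠ q → 1 ≤ dist p q) (hPX : P ⊆ X)
    (U : Finset (EuclideanSpace ℝ (Fin 3)))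
    (hU : ∀ d ∈ U, d ∈ fccStacking 1 (Real.sqrt (2 / 3)) ∧ ‖d‖ = 1) (hUneg : ∀ d ∈ U, -d ∈ U)
    (hUcard : U.card = 12) (ν : EuclideanSpace ℝ (Fin 3)) (q : EuclideanSpace ℝ (Fin 3)) (hq : q ∈ X \ P) :
    2 * ((P.filter fun p => dist q p = 1).card : ℤ) + (((X \ P).filter fun x => dist q x = 1).card : ℤ)
      + ∑ x ∈ (X \ P).filter (fun x => dist q x = 1),
          (((if ∃ d ∈ U, ⟪d, ν⟫_ℝ < 0 ∧ Real.sqrt 3 / 2 < ⟪x - q, d⟫_ℝ then (1 : ℤ) else 0)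
            + (if (∀ d ∈ U, ⟪x - q, d⟫_ℝ ≤ Real.sqrt 3 / 2) ∧ ⟪x, ν⟫_ℝ < ⟪q, ν⟫_ℝ then (1 : ℤ) else 0))
          - ((if ∃ d ∈ U, ⟪d, ν⟫_ℝ < 0 ∧ Real.sqrt 3 / 2 < ⟪q - x, d⟫_ℝ then (1 : ℤ) else 0)
            + (if (∀ d ∈ U, ⟪q - x, d⟫_ℝ ≤ Real.sqrt 3 / 2) ∧ ⟪q, ν⟫_ℝ < ⟪x, ν⟫_ℝ then (1 : ℤ) else 0)))
    = 12 + 2 * ((P.filter fun p => dist q p = 1 ∧ ∀ d ∈ U, ⟪p - q, d⟫_ℝ ≤ Real.sqrt 3 / 2).card : ℤ)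
      + 2 * (((X \ P).filter fun x => dist q x = 1 ∧ (∀ d ∈ U, ⟪x - q, d⟫_ℝ ≤ Real.sqrt 3 / 2) ∧
          ⟪x, ν⟫_ℝ < ⟪q, ν⟫_ℝ).card : ℤ)
      + (((X \ P).filter fun x => dist q x = 1 ∧ (∀ d ∈ U, ⟪x - q, d⟫_ℝ ≤ Real.sqrt 3 / 2) ∧
          ⟪x, ν⟫_ℝ = ⟪q, ν⟫_ℝ).card : ℤ)
      - 2 * ((U.filter fun d => ⟪d, ν⟫_ℝ < 0 ∧ ∀ x ∈ X, dist q x = 1 → ⟪x - q, d⟫_ℝ ≤ Real.sqrt 3 / 2).card : ℤ)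
      - ((U.filter fun d => ⟪d, ν⟫_ℝ = 0 ∧ ∀ x ∈ X, dist q x = 1 → ⟪x - q, d⟫_ℝ ≤ Real.sqrt 3 / 2).card : ℤ)
      + 2 * ((U.filter fun d => 0 < ⟪d, ν⟫_ℝ ∧ ∃ p ∈ P, dist q p = 1 ∧ Real.sqrt 3 / 2 < ⟪p - q, d⟫_ℝ).card : ℤ)
      + ((U.filter fun d => ⟪d, ν⟫_ℝ = 0 ∧ ∃ p ∈ P, dist q p = 1 ∧ Real.sqrt 3 / 2 < ⟪p - q, d⟫_ℝ).card : ℤ) := by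
  classical
  set c : ℝ := Real.sqrt 3 / 2 with hc
  set NP := P.filter fun p => dist q p = 1 with hNP
  set NF := (X \ P).filter fun x => dist q x = 1 with hNF
  -- occupancy predicates for a cap `d`
  set oP : EuclideanSpace ℝ (Fin 3) → Prop := fun d => ∃ p ∈ NP, c < ⟪p - q, d⟫_ℝ with hoP
  set oF : EuclideanSpace ℝ (Fin 3) → Prop := fun d => ∃ x ∈ NF, c < ⟪x - q, d⟫_ℝ with hoF
  set vc : EuclideanSpace ℝ (Fin 3) → Prop := fun d => ∀ x ∈ X, dist q x = 1 → ⟪x - q, d⟫_ℝ ≤ c with hvc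
  have hqX : q ∈ X := (mem_sdiff.1 hq).1
  have hqP : q ∉ P := (mem_sdiff.1 hq).2
  have hNPX : ∀ p ∈ NP, p ∈ X ∧ dist q p = 1 := fun p hp =>
    ⟨hPX (mem_filter.1 hp).1, (mem_filter.1 hp).2⟩
  have hNFX : ∀ x ∈ NF, x ∈ X ∧ dist q x = 1 := fun x hx =>
    ⟨(mem_sdiff.1 (mem_filter.1 hx).1).1, (mem_filter.1 hx).2⟩
  -- (1) exclusivity / exhaustivity of the three occupancy states
  have hexcl : ∀ d ∈ U, ¬ (oP d ∧ oF d) := by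
    rintro d hd ⟨⟨p, hp, hpd⟩, ⟨x, hx, hxd⟩⟩
    have := capPartner_unique X hX (hNPX p hp).1 (hNFX x hx).1 (hNPX p hp).2 (hNFX x hx).2 (hU d hd).2 hpd hxd
    exact (mem_sdiff.1 (mem_filter.1 hx).1).2 (this ▸ (mem_filter.1 hp).1)
  have hvc_iff : ∀ d ∈ U, vc d ↔ ¬ (oP d ∨ oF d) := by
    intro d hd
    constructor
    · rintro h (⟨p, hp, hpd⟩ | ⟨x, hx, hxd⟩)
      · exact absurd (h p (hNPX p hp).1 (hNPX p hp).2) (not_le.2 hpd)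
      · exact absurd (h x (hNFX x hx).1 (hNFX x hx).2) (not_le.2 hxd)
    · intro h x hxX hqx
      by_contra hle
      have hlt : c < ⟪x - q, d⟫_ℝ := lt_of_not_ge hle
      by_cases hxP : x ∈ P
      · exact h (Or.inl ⟨x, mem_filter.2 ⟨hxP, hqx⟩, hlt⟩)
      · exact h (Or.inr ⟨x, mem_filter.2 ⟨mem_sdiff.2 ⟨hxX, hxP⟩, hqx⟩, hlt⟩)
  -- the three-way split of any `S ⊆ U`
  have hsplit : ∀ S : Finset (EuclideanSpace ℝ (Fin 3)), S ⊆ U →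
      (S.card : ℤ) = (S.filter oP).card + (S.filter oF).card + (S.filter vc).card := by
    intro S hS
    have h1 := card_filter_add_card_filter_not (s := S) (fun d => oP d ∨ oF d)
    have h2 : (S.filter fun d => oP d ∨ oF d).card = (S.filter oP).card + (S.filter oF).card := by
      rw [filter_or, card_union_of_disjoint]
      exact disjoint_filter.2 fun d hd h1 h2 => hexcl d (hS hd) ⟨h1, h2⟩
    have h3 : (S.filter fun d => ¬ (oP d ∨ oF d)) = S.filter vc :=
      filter_congr fun d hd => (hvc_iff d (hS hd)).symm
    rw [h2, h3] at h1
    omega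
  -- (2) registered contacts ↔ occupied caps (double counts)
  have hregP : ((NP.filter fun p => ∃ d ∈ U, c < ⟪p - q, d⟫_ℝ).card : ℤ) = (U.filter oP).card := by
    have := card_filter_exists_comm NP U (fun p d => c < ⟪p - q, d⟫_ℝ)
      (fun p hp d hd d' hd' h1 h2 => capDir_unique (hNPX p hp).2 (hU d hd).1 (hU d' hd').1 (hU d hd).2
        (hU d' hd').2 h1 h2)
      (fun d hd p hp p' hp' h1 h2 => capPartner_unique X hX (hNPX p hp).1 (hNPX p' hp').1 (hNPX p hp).2
        (hNPX p' hp').2 (hU d hd).2 h1 h2)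
    exact_mod_cast this
  have hregF : ((NF.filter fun x => ∃ d ∈ U, c < ⟪x - q, d⟫_ℝ).card : ℤ) = (U.filter oF).card := by
    have := card_filter_exists_comm NF U (fun x d => c < ⟪x - q, d⟫_ℝ)
      (fun x hx d hd d' hd' h1 h2 => capDir_unique (hNFX x hx).2 (hU d hd).1 (hU d' hd').1 (hU d hd).2
        (hU d' hd').2 h1 h2)
      (fun d hd x hx x' hx' h1 h2 => capPartner_unique X hX (hNFX x hx).1 (hNFX x' hx').1 (hNFX x hx).2
        (hNFX x' hx').2 (hU d hd).2 h1 h2)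
    exact_mod_cast this
  -- restricted to the down-caps and the up-caps
  set Dn := U.filter fun d => ⟪d, ν⟫_ℝ < 0 with hDn
  set Up := U.filter fun d => 0 < ⟪d, ν⟫_ℝ with hUp
  set Lv := U.filter fun d => ⟪d, ν⟫_ℝ = 0 with hLv
  have hDnU : Dn ⊆ U := filter_subset _ _
  have hUpU : Up ⊆ U := filter_subset _ _
  have hLvU : Lv ⊆ U := filter_subset _ _
  have hregFDn : ((NF.filter fun x => ∃ d ∈ U, ⟪d, ν⟫_ℝ < 0 ∧ c < ⟪x - q, d⟫_ℝ).card : ℤ) =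
      (Dn.filter oF).card := by
    have := card_filter_exists_comm NF Dn (fun x d => c < ⟪x - q, d⟫_ℝ)
      (fun x hx d hd d' hd' h1 h2 => capDir_unique (hNFX x hx).2 (hU d (hDnU hd)).1 (hU d' (hDnU hd')).1
        (hU d (hDnU hd)).2 (hU d' (hDnU hd')).2 h1 h2)
      (fun d hd x hx x' hx' h1 h2 => capPartner_unique X hX (hNFX x hx).1 (hNFX x' hx').1 (hNFX x hx).2
        (hNFX x' hx').2 (hU d (hDnU hd)).2 h1 h2)
    have e : (NF.filter fun x => ∃ d ∈ U, ⟪d, ν⟫_ℝ < 0 ∧ c < ⟪x - q, d⟫_ℝ) =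
        NF.filter fun x => ∃ d ∈ Dn, c < ⟪x - q, d⟫_ℝ := by
      refine filter_congr fun x _ => ?_
      simp only [hDn, mem_filter, and_assoc]
    rw [e]; exact_mod_cast this
  have hregFUp : ((NF.filter fun x => ∃ d ∈ U, 0 < ⟪d, ν⟫_ℝ ∧ c < ⟪x - q, d⟫_ℝ).card : ℤ) =
      (Up.filter oF).card := by
    have := card_filter_exists_comm NF Up (fun x d => c < ⟪x - q, d⟫_ℝ)
      (fun x hx d hd d' hd' h1 h2 => capDir_unique (hNFX x hx).2 (hU d (hUpU hd)).1 (hU d' (hUpU hd')).1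
        (hU d (hUpU hd)).2 (hU d' (hUpU hd')).2 h1 h2)
      (fun d hd x hx x' hx' h1 h2 => capPartner_unique X hX (hNFX x hx).1 (hNFX x' hx').1 (hNFX x hx).2
        (hNFX x' hx').2 (hU d (hUpU hd)).2 h1 h2)
    have e : (NF.filter fun x => ∃ d ∈ U, 0 < ⟪d, ν⟫_ℝ ∧ c < ⟪x - q, d⟫_ℝ) =
        NF.filter fun x => ∃ d ∈ Up, c < ⟪x - q, d⟫_ℝ := by
      refine filter_congr fun x _ => ?_
      simp only [hUp, mem_filter, and_assoc]
    rw [e]; exact_mod_cast this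
  -- (3) partitions of `U` by the sign of `⟪d, ν⟫`
  have hUsplit : ∀ (R : EuclideanSpace ℝ (Fin 3) → Prop) [DecidablePred R],
      ((U.filter R).card : ℤ) = (Dn.filter R).card + (Up.filter R).card + (Lv.filter R).card := by
    intro R _
    have h1 := card_filter_add_card_filter_not (s := U.filter R) (fun d => ⟪d, ν⟫_ℝ < 0)
    have h2 := card_filter_add_card_filter_not (s := (U.filter R).filter fun d => ¬ ⟪d, ν⟫_ℝ < 0)
      (fun d => 0 < ⟪d, ν⟫_ℝ)
    have e1 : (U.filter R).filter (fun d => ⟪d, ν⟫_ℝ < 0) = Dn.filter R := by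
      ext d; simp only [hDn, mem_filter]
      constructor
      · rintro ⟨⟨h1, h2⟩, h3⟩; exact ⟨⟨h1, h3⟩, h2⟩
      · rintro ⟨⟨h1, h3⟩, h2⟩; exact ⟨⟨h1, h2⟩, h3⟩
    have e2 : ((U.filter R).filter fun d => ¬ ⟪d, ν⟫_ℝ < 0).filter (fun d => 0 < ⟪d, ν⟫_ℝ) = Up.filter R := by
      ext d; simp only [hUp, mem_filter]
      constructor
      · rintro ⟨⟨⟨h1, h2⟩, _⟩, h4⟩; exact ⟨⟨h1, h4⟩, h2⟩
      · rintro ⟨⟨h1, h4⟩, h2⟩; exact ⟨⟨⟨h1, h2⟩, not_lt.2 h4.le⟩, h4⟩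
    have e3 : ((U.filter R).filter fun d => ¬ ⟪d, ν⟫_ℝ < 0).filter (fun d => ¬ 0 < ⟪d, ν⟫_ℝ) = Lv.filter R := by
      ext d; simp only [hLv, mem_filter]
      constructor
      · rintro ⟨⟨⟨h1, h2⟩, h3⟩, h4⟩; exact ⟨⟨h1, le_antisymm (not_lt.1 h4) (not_lt.1 h3)⟩, h2⟩
      · rintro ⟨⟨h1, h4⟩, h2⟩; exact ⟨⟨⟨h1, h2⟩, by rw [h4]; exact lt_irrefl 0⟩, by rw [h4]; exact lt_irrefl 0⟩
    rw [e1] at h1; rw [e2, e3] at h2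
    omega
  -- `#Up = #Dn` by negation
  have hUpDn : Up.card = Dn.card := by
    refine card_bij (fun d _ => -d) (fun d hd => ?_) (fun d _ d' _ h => neg_inj.1 h) (fun d hd => ?_)
    · obtain ⟨hdU, hdν⟩ := mem_filter.1 hd
      exact mem_filter.2 ⟨hUneg d hdU, by rw [inner_neg_left]; linarith⟩
    · obtain ⟨hdU, hdν⟩ := mem_filter.1 hd
      exact ⟨-d, mem_filter.2 ⟨hUneg d hdU, by rw [inner_neg_left]; linarith⟩, neg_neg d⟩
  -- (4) registered / interstitial splits of the contacts
  have hsplitP : (NP.card : ℤ) = (NP.filter fun p => ∃ d ∈ U, c < ⟪p - q, d⟫_ℝ).card +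
      (NP.filter fun p => ∀ d ∈ U, ⟪p - q, d⟫_ℝ ≤ c).card := by
    have h := card_filter_add_card_filter_not (s := NP) (fun p => ∃ d ∈ U, c < ⟪p - q, d⟫_ℝ)
    have e : (NP.filter fun p => ¬ ∃ d ∈ U, c < ⟪p - q, d⟫_ℝ) = NP.filter fun p => ∀ d ∈ U, ⟪p - q, d⟫_ℝ ≤ c := by
      refine filter_congr fun p _ => ?_
      simp only [not_exists, not_and, not_lt]
    rw [e] at h; omega
  have hsplitF : (NF.card : ℤ) = (NF.filter fun x => ∃ d ∈ U, c < ⟪x - q, d⟫_ℝ).card +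
      (NF.filter fun x => ∀ d ∈ U, ⟪x - q, d⟫_ℝ ≤ c).card := by
    have h := card_filter_add_card_filter_not (s := NF) (fun x => ∃ d ∈ U, c < ⟪x - q, d⟫_ℝ)
    have e : (NF.filter fun x => ¬ ∃ d ∈ U, c < ⟪x - q, d⟫_ℝ) = NF.filter fun x => ∀ d ∈ U, ⟪x - q, d⟫_ℝ ≤ c := by
      refine filter_congr fun x _ => ?_
      simp only [not_exists, not_and, not_lt]
    rw [e] at h; omega
  -- interstitial film contacts by height
  have hintF : ((NF.filter fun x => ∀ d ∈ U, ⟪x - q, d⟫_ℝ ≤ c).card : ℤ) =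
      (NF.filter fun x => (∀ d ∈ U, ⟪x - q, d⟫_ℝ ≤ c) ∧ ⟪x, ν⟫_ℝ < ⟪q, ν⟫_ℝ).card +
      (NF.filter fun x => (∀ d ∈ U, ⟪x - q, d⟫_ℝ ≤ c) ∧ ⟪q, ν⟫_ℝ < ⟪x, ν⟫_ℝ).card +
      (NF.filter fun x => (∀ d ∈ U, ⟪x - q, d⟫_ℝ ≤ c) ∧ ⟪x, ν⟫_ℝ = ⟪q, ν⟫_ℝ).card := by
    simp only [card_filter, Nat.cast_sum, Nat.cast_ite, Nat.cast_one, Nat.cast_zero, ← sum_add_distrib]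
    refine sum_congr rfl fun x _ => ?_
    by_cases h : ∀ d ∈ U, ⟪x - q, d⟫_ℝ ≤ c
    · rcases lt_trichotomy ⟪x, ν⟫_ℝ ⟪q, ν⟫_ℝ with hlt | heq | hgt
      · rw [if_pos h, if_pos ⟨h, hlt⟩, if_neg fun h' => (not_lt.2 hlt.le) h'.2, if_neg fun h' => hlt.ne h'.2]
        norm_num
      · rw [if_pos h, if_neg fun h' => (lt_irrefl _) (heq ▸ h'.2), if_neg fun h' => (lt_irrefl _) (heq ▸ h'.2),
          if_pos ⟨h, heq⟩]
        norm_num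
      · rw [if_pos h, if_neg fun h' => (not_lt.2 hgt.le) h'.2, if_pos ⟨h, hgt⟩, if_neg fun h' => hgt.ne' h'.2]
        norm_num
    · rw [if_neg h, if_neg fun h' => h h'.1, if_neg fun h' => h h'.1, if_neg fun h' => h h'.1]
      norm_num
  -- (5) the transfer sum
  have hsym_int : ∀ x, (∀ d ∈ U, ⟪q - x, d⟫_ℝ ≤ c) ↔ (∀ d ∈ U, ⟪x - q, d⟫_ℝ ≤ c) := by
    intro x
    constructor
    · intro h d hd
      have := h (-d) (hUneg d hd)
      rwa [inner_neg_right, ← inner_neg_left, neg_sub] at this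
    · intro h d hd
      have := h (-d) (hUneg d hd)
      rwa [inner_neg_right, ← inner_neg_left, neg_sub] at this
  have hsym_dn : ∀ x, (∃ d ∈ U, ⟪d, ν⟫_ℝ < 0 ∧ c < ⟪q - x, d⟫_ℝ) ↔ (∃ d ∈ U, 0 < ⟪d, ν⟫_ℝ ∧ c < ⟪x - q, d⟫_ℝ) := by
    intro x
    constructor
    · rintro ⟨d, hd, hdν, hdx⟩
      refine ⟨-d, hUneg d hd, by rw [inner_neg_left]; linarith, ?_⟩
      rwa [inner_neg_right, ← inner_neg_left, neg_sub]
    · rintro ⟨d, hd, hdν, hdx⟩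
      refine ⟨-d, hUneg d hd, by rw [inner_neg_left]; linarith, ?_⟩
      rwa [inner_neg_right, ← inner_neg_left, neg_sub]
  have hsum : ∑ x ∈ NF,
      (((if ∃ d ∈ U, ⟪d, ν⟫_ℝ < 0 ∧ c < ⟪x - q, d⟫_ℝ then (1 : ℤ) else 0)
        + (if (∀ d ∈ U, ⟪x - q, d⟫_ℝ ≤ c) ∧ ⟪x, ν⟫_ℝ < ⟪q, ν⟫_ℝ then (1 : ℤ) else 0))
      - ((if ∃ d ∈ U, ⟪d, ν⟫_ℝ < 0 ∧ c < ⟪q - x, d⟫_ℝ then (1 : ℤ) else 0)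
        + (if (∀ d ∈ U, ⟪q - x, d⟫_ℝ ≤ c) ∧ ⟪q, ν⟫_ℝ < ⟪x, ν⟫_ℝ then (1 : ℤ) else 0))) =
      ((NF.filter fun x => ∃ d ∈ U, ⟪d, ν⟫_ℝ < 0 ∧ c < ⟪x - q, d⟫_ℝ).card : ℤ)
      + (NF.filter fun x => (∀ d ∈ U, ⟪x - q, d⟫_ℝ ≤ c) ∧ ⟪x, ν⟫_ℝ < ⟪q, ν⟫_ℝ).card
      - (NF.filter fun x => ∃ d ∈ U, 0 < ⟪d, ν⟫_ℝ ∧ c < ⟪x - q, d⟫_ℝ).card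
      - (NF.filter fun x => (∀ d ∈ U, ⟪x - q, d⟫_ℝ ≤ c) ∧ ⟪q, ν⟫_ℝ < ⟪x, ν⟫_ℝ).card := by
    have e1 : ∀ x ∈ NF, (if ∃ d ∈ U, ⟪d, ν⟫_ℝ < 0 ∧ c < ⟪q - x, d⟫_ℝ then (1 : ℤ) else 0) =
        (if ∃ d ∈ U, 0 < ⟪d, ν⟫_ℝ ∧ c < ⟪x - q, d⟫_ℝ then (1 : ℤ) else 0) := fun x _ => by
      rw [if_congr (hsym_dn x) rfl rfl]
    have e2 : ∀ x ∈ NF, (if (∀ d ∈ U, ⟪q - x, d⟫_ℝ ≤ c) ∧ ⟪q, ν⟫_ℝ < ⟪x, ν⟫_ℝ then (1 : ℤ) else 0) =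
        (if (∀ d ∈ U, ⟪x - q, d⟫_ℝ ≤ c) ∧ ⟪q, ν⟫_ℝ < ⟪x, ν⟫_ℝ then (1 : ℤ) else 0) := fun x _ => by
      rw [if_congr (and_congr (hsym_int x) Iff.rfl) rfl rfl]
    rw [sum_congr rfl fun x hx => by rw [e1 x hx, e2 x hx]]
    simp only [sum_sub_distrib, sum_add_distrib, card_filter, Nat.cast_sum, Nat.cast_ite, Nat.cast_one,
      Nat.cast_zero]
    ring
  -- (6) vacancy filters in the statement are the `vc` filters
  have hvD : (U.filter fun d => ⟪d, ν⟫_ℝ < 0 ∧ ∀ x ∈ X, dist q x = 1 → ⟪x - q, d⟫_ℝ ≤ c) = Dn.filter vc := by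
    rw [hDn, filter_filter]
  have hvL : (U.filter fun d => ⟪d, ν⟫_ℝ = 0 ∧ ∀ x ∈ X, dist q x = 1 → ⟪x - q, d⟫_ℝ ≤ c) = Lv.filter vc := by
    rw [hLv, filter_filter]
  -- assemble
  have h12 : (U.card : ℤ) = 12 := by exact_mod_cast hUcard
  have sU := hsplit U (Subset.refl _)
  have sDn := hsplit Dn hDnU
  have sUp := hsplit Up hUpU
  have sLv := hsplit Lv hLvU
  have pP := hUsplit oP
  have pF := hUsplit oF
  have pV := hUsplit vc
  have hUD : (Up.card : ℤ) = Dn.card := by exact_mod_cast hUpDn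
  have r1 : (P.filter fun p => dist q p = 1 ∧ ∀ d ∈ U, ⟪p - q, d⟫_ℝ ≤ c) =
      NP.filter fun p => ∀ d ∈ U, ⟪p - q, d⟫_ℝ ≤ c := by rw [hNP, filter_filter]
  have r2 : ((X \ P).filter fun x => dist q x = 1 ∧ (∀ d ∈ U, ⟪x - q, d⟫_ℝ ≤ c) ∧ ⟪x, ν⟫_ℝ < ⟪q, ν⟫_ℝ) =
      NF.filter fun x => (∀ d ∈ U, ⟪x - q, d⟫_ℝ ≤ c) ∧ ⟪x, ν⟫_ℝ < ⟪q, ν⟫_ℝ := by rw [hNF, filter_filter]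
  have r3 : ((X \ P).filter fun x => dist q x = 1 ∧ (∀ d ∈ U, ⟪x - q, d⟫_ℝ ≤ c) ∧ ⟪x, ν⟫_ℝ = ⟪q, ν⟫_ℝ) =
      NF.filter fun x => (∀ d ∈ U, ⟪x - q, d⟫_ℝ ≤ c) ∧ ⟪x, ν⟫_ℝ = ⟪q, ν⟫_ℝ := by rw [hNF, filter_filter]
  have r5 : (U.filter fun d => 0 < ⟪d, ν⟫_ℝ ∧ ∃ p ∈ P, dist q p = 1 ∧ c < ⟪p - q, d⟫_ℝ) = Up.filter oP := by
    rw [hUp, filter_filter]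
    refine filter_congr fun d _ => and_congr Iff.rfl ?_
    simp only [hoP, hNP, mem_filter, and_assoc]
  have r6 : (U.filter fun d => ⟪d, ν⟫_ℝ = 0 ∧ ∃ p ∈ P, dist q p = 1 ∧ c < ⟪p - q, d⟫_ℝ) = Lv.filter oP := by
    rw [hLv, filter_filter]
    refine filter_congr fun d _ => and_congr Iff.rfl ?_
    simp only [hoP, hNP, mem_filter, and_assoc]
  rw [r1, r2, r3, r5, r6, hsum, hvD, hvL, hregFDn, hregFUp]
  rw [hregP] at hsplitP
  rw [hregF, hintF] at hsplitF
  linarith [sU, sDn, sUp, sLv, pP, pF, pV, hUD, hsplitP, hsplitF, h12]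
/-- **Per-ball cap accounting, upper form** (used by the gain bound): the rim terms are bounded by
twice the number of substrate contacts of `q` lying in a cap `d` with `⟪d, ν⟫ ≥ 0`. -/
theorem perBall_capAccount (X P : Finset (EuclideanSpace ℝ (Fin 3)))
    (hX : ∀ p ∈ X, ∀ q ∈ X, p ≠ q → 1 ≤ dist p q) (hPX : P ⊆ X)
    (U : Finset (EuclideanSpace ℝ (Fin 3)))
    (hU : ∀ d ∈ U, d ∈ fccStacking 1 (Real.sqrt (2 / 3)) ∧ ‖d‖ = 1) (hUneg : ∀ d ∈ U, -d ∈ U)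
    (hUcard : U.card = 12) (ν : EuclideanSpace ℝ (Fin 3)) (q : EuclideanSpace ℝ (Fin 3)) (hq : q ∈ X \ P) :
    2 * ((P.filter fun p => dist q p = 1).card : ℤ) + (((X \ P).filter fun x => dist q x = 1).card : ℤ)
      + ∑ x ∈ (X \ P).filter (fun x => dist q x = 1),
          (((if ∃ d ∈ U, ⟪d, ν⟫_ℝ < 0 ∧ Real.sqrt 3 / 2 < ⟪x - q, d⟫_ℝ then (1 : ℤ) else 0)
            + (if (∀ d ∈ U, ⟪x - q, d⟫_ℝ ≤ Real.sqrt 3 / 2) ∧ ⟪x, ν⟫_ℝ < ⟪q, ν⟫_ℝ then (1 : ℤ) else 0))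
          - ((if ∃ d ∈ U, ⟪d, ν⟫_ℝ < 0 ∧ Real.sqrt 3 / 2 < ⟪q - x, d⟫_ℝ then (1 : ℤ) else 0)
            + (if (∀ d ∈ U, ⟪q - x, d⟫_ℝ ≤ Real.sqrt 3 / 2) ∧ ⟪q, ν⟫_ℝ < ⟪x, ν⟫_ℝ then (1 : ℤ) else 0)))
    ≤ 12 + 2 * ((P.filter fun p => dist q p = 1 ∧ ∀ d ∈ U, ⟪p - q, d⟫_ℝ ≤ Real.sqrt 3 / 2).card : ℤ)
      + 2 * (((X \ P).filter fun x => dist q x = 1 ∧ (∀ d ∈ U, ⟪x - q, d⟫_ℝ ≤ Real.sqrt 3 / 2) ∧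
          ⟪x, ν⟫_ℝ < ⟪q, ν⟫_ℝ).card : ℤ)
      + (((X \ P).filter fun x => dist q x = 1 ∧ (∀ d ∈ U, ⟪x - q, d⟫_ℝ ≤ Real.sqrt 3 / 2) ∧
          ⟪x, ν⟫_ℝ = ⟪q, ν⟫_ℝ).card : ℤ)
      - 2 * ((U.filter fun d => ⟪d, ν⟫_ℝ < 0 ∧ ∀ x ∈ X, dist q x = 1 → ⟪x - q, d⟫_ℝ ≤ Real.sqrt 3 / 2).card : ℤ)
      - ((U.filter fun d => ⟪d, ν⟫_ℝ = 0 ∧ ∀ x ∈ X, dist q x = 1 → ⟪x - q, d⟫_ℝ ≤ Real.sqrt 3 / 2).card : ℤ)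
      + 2 * ((P.filter fun p => dist q p = 1 ∧ ∃ d ∈ U, 0 ≤ ⟪d, ν⟫_ℝ ∧ Real.sqrt 3 / 2 < ⟪p - q, d⟫_ℝ).card : ℤ) := by
  classical
  have heq := perBall_capAccount_eq X P hX hPX U hU hUneg hUcard ν q hq
  set c : ℝ := Real.sqrt 3 / 2 with hc
  set NP := P.filter fun p => dist q p = 1 with hNP
  have hNPX : ∀ p ∈ NP, p ∈ X ∧ dist q p = 1 := fun p hp =>
    ⟨hPX (mem_filter.1 hp).1, (mem_filter.1 hp).2⟩
  -- substrate contacts in up-or-level caps, double counted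
  set Ge := U.filter fun d => 0 ≤ ⟪d, ν⟫_ℝ with hGe
  have hGeU : Ge ⊆ U := filter_subset _ _
  have hdc := card_filter_exists_comm NP Ge (fun p d => c < ⟪p - q, d⟫_ℝ)
    (fun p hp d hd d' hd' h1 h2 => capDir_unique (hNPX p hp).2 (hU d (hGeU hd)).1 (hU d' (hGeU hd')).1
      (hU d (hGeU hd)).2 (hU d' (hGeU hd')).2 h1 h2)
    (fun d hd p hp p' hp' h1 h2 => capPartner_unique X hX (hNPX p hp).1 (hNPX p' hp').1 (hNPX p hp).2
      (hNPX p' hp').2 (hU d (hGeU hd)).2 h1 h2)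
  have e1 : (P.filter fun p => dist q p = 1 ∧ ∃ d ∈ U, 0 ≤ ⟪d, ν⟫_ℝ ∧ c < ⟪p - q, d⟫_ℝ) =
      NP.filter fun p => ∃ d ∈ Ge, c < ⟪p - q, d⟫_ℝ := by
    rw [hNP, filter_filter]
    refine filter_congr fun x _ => and_congr Iff.rfl ?_
    simp only [hGe, mem_filter, and_assoc]
  have e2 : (Ge.filter fun d => ∃ p ∈ NP, c < ⟪p - q, d⟫_ℝ).card =
      (U.filter fun d => 0 < ⟪d, ν⟫_ℝ ∧ ∃ p ∈ P, dist q p = 1 ∧ c < ⟪p - q, d⟫_ℝ).card +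
      (U.filter fun d => ⟪d, ν⟫_ℝ = 0 ∧ ∃ p ∈ P, dist q p = 1 ∧ c < ⟪p - q, d⟫_ℝ).card := by
    rw [← card_union_of_disjoint]
    · congr 1
      ext d
      simp only [hGe, hNP, mem_union, mem_filter, and_assoc]
      constructor
      · rintro ⟨hdU, hge, hex⟩
        rcases hge.lt_or_eq with hlt | heq'
        · exact Or.inl ⟨hdU, hlt, hex⟩
        · exact Or.inr ⟨hdU, heq'.symm, hex⟩
      · rintro (⟨hdU, hlt, hex⟩ | ⟨hdU, heq', hex⟩)
        · exact ⟨hdU, hlt.le, hex⟩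
        · exact ⟨hdU, heq'.symm.le, hex⟩
    · exact disjoint_filter.2 fun d _ h1 h2 => absurd h2.1 h1.1.ne'
  have key : ((U.filter fun d => 0 < ⟪d, ν⟫_ℝ ∧ ∃ p ∈ P, dist q p = 1 ∧ c < ⟪p - q, d⟫_ℝ).card : ℤ) +
      ((U.filter fun d => ⟪d, ν⟫_ℝ = 0 ∧ ∃ p ∈ P, dist q p = 1 ∧ c < ⟪p - q, d⟫_ℝ).card : ℤ) =
      ((P.filter fun p => dist q p = 1 ∧ ∃ d ∈ U, 0 ≤ ⟪d, ν⟫_ℝ ∧ c < ⟪p - q, d⟫_ℝ).card : ℤ) := by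
    rw [e1, hdc]; exact_mod_cast e2.symm
  rw [heq]
  linarith [key, Int.natCast_nonneg
    (U.filter fun d => ⟪d, ν⟫_ℝ = 0 ∧ ∃ p ∈ P, dist q p = 1 ∧ c < ⟪p - q, d⟫_ℝ).card]

/-- **Per-ball cap accounting, lower form**: dropping the (nonnegative) rim terms. -/
theorem perBall_capAccount_ge (X P : Finset (EuclideanSpace ℝ (Fin 3)))
    (hX : ∀ p ∈ X, ∀ q ∈ X, p ≠ q → 1 ≤ dist p q) (hPX : P ⊆ X)
    (U : Finset (EuclideanSpace ℝ (Fin 3)))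
    (hU : ∀ d ∈ U, d ∈ fccStacking 1 (Real.sqrt (2 / 3)) ∧ ‖d‖ = 1) (hUneg : ∀ d ∈ U, -d ∈ U)
    (hUcard : U.card = 12) (ν : EuclideanSpace ℝ (Fin 3)) (q : EuclideanSpace ℝ (Fin 3)) (hq : q ∈ X \ P) :
    12 + 2 * ((P.filter fun p => dist q p = 1 ∧ ∀ d ∈ U, ⟪p - q, d⟫_ℝ ≤ Real.sqrt 3 / 2).card : ℤ)
      + 2 * (((X \ P).filter fun x => dist q x = 1 ∧ (∀ d ∈ U, ⟪x - q, d⟫_ℝ ≤ Real.sqrt 3 / 2) ∧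
          ⟪x, ν⟫_ℝ < ⟪q, ν⟫_ℝ).card : ℤ)
      + (((X \ P).filter fun x => dist q x = 1 ∧ (∀ d ∈ U, ⟪x - q, d⟫_ℝ ≤ Real.sqrt 3 / 2) ∧
          ⟪x, ν⟫_ℝ = ⟪q, ν⟫_ℝ).card : ℤ)
      - 2 * ((U.filter fun d => ⟪d, ν⟫_ℝ < 0 ∧ ∀ x ∈ X, dist q x = 1 → ⟪x - q, d⟫_ℝ ≤ Real.sqrt 3 / 2).card : ℤ)
      - ((U.filter fun d => ⟪d, ν⟫_ℝ = 0 ∧ ∀ x ∈ X, dist q x = 1 → ⟪x - q, d⟫_ℝ ≤ Real.sqrt 3 / 2).card : ℤ)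
    ≤ 2 * ((P.filter fun p => dist q p = 1).card : ℤ) + (((X \ P).filter fun x => dist q x = 1).card : ℤ)
      + ∑ x ∈ (X \ P).filter (fun x => dist q x = 1),
          (((if ∃ d ∈ U, ⟪d, ν⟫_ℝ < 0 ∧ Real.sqrt 3 / 2 < ⟪x - q, d⟫_ℝ then (1 : ℤ) else 0)
            + (if (∀ d ∈ U, ⟪x - q, d⟫_ℝ ≤ Real.sqrt 3 / 2) ∧ ⟪x, ν⟫_ℝ < ⟪q, ν⟫_ℝ then (1 : ℤ) else 0))
          - ((if ∃ d ∈ U, ⟪d, ν⟫_ℝ < 0 ∧ Real.sqrt 3 / 2 < ⟪q - x, d⟫_ℝ then (1 : ℤ) else 0)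
            + (if (∀ d ∈ U, ⟪q - x, d⟫_ℝ ≤ Real.sqrt 3 / 2) ∧ ⟪q, ν⟫_ℝ < ⟪x, ν⟫_ℝ then (1 : ℤ) else 0))) := by
  have heq := perBall_capAccount_eq X P hX hPX U hU hUneg hUcard ν q hq
  rw [heq]
  linarith [Int.natCast_nonneg
      (U.filter fun d => 0 < ⟪d, ν⟫_ℝ ∧ ∃ p ∈ P, dist q p = 1 ∧ Real.sqrt 3 / 2 < ⟪p - q, d⟫_ℝ).card,
    Int.natCast_nonneg
      (U.filter fun d => ⟪d, ν⟫_ℝ = 0 ∧ ∃ p ∈ P, dist q p = 1 ∧ Real.sqrt 3 / 2 < ⟪p - q, d⟫_ℝ).card]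

end Summit.Ventures.Crystal3D.Theorems

end
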